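import Literature.Barriers.CriticalPhenomena.WeaklySAWQuadraticFlowDeriv2
import HarnessLib

/-!
# [BBS-rg-flow, Lemma 2.3, second derivatives, (2.34) for `μ̄`]: `μ̄_j'' = O(χ_jḡ_j²/ḡ₀³)`

Continuation of `WeaklySAWQuadraticFlowDeriv2.lean` (`ḡ_j'' = gbarDeriv2`, `z̄_j'' = zbarDeriv2` with
(2.34) for `ḡ`, `z̄`) and `WeaklySAWQuadraticFlowDeriv.lean` (`τ'`, `σ'`, `(∏(λ-τ)⁻¹)'`, `μ̄'`).
Source: Bauerschmidt–Brydges–Slade, AHP 16 (2015), arXiv:1211.2477, Lemma 2.3, (2.34):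
"`μ̄_j'' = O(χ_jḡ_j²/ḡ₀³)`", proof: "Straightforward further calculation leads to the bound on
`μ̄_j''` claimed in (2.34) (the leading behaviour can be seen from the `z̄_j''` contribution to the
`σ_l''` term)." With the two previous files this completes the printed Lemma 2.3 (existence and size
of the first and second derivatives of `V̄_j` in the initial condition), the input of [BBS-rg-flow,
Lemma 3.4] towards Theorem 1.4(ii) = BBS 2015, Theorem 7.2.1(ii).

## What this file proves

Under `CutoffQuadHyp P Ω k B c N C lam b` and `8B²C_{2,0}b ≤ 1` (`C_{2,0} = (1+N)/c + N + 2Ω/(Ω-1)`,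
`α = 2/(1+λ)`):
* `tauDeriv2`, `sigmaDeriv2`, `lamLogDeriv2`, `lamInvProdDeriv2`, `mubarDerivTerm2`, `mubarDeriv2` (the
  second derivatives of `τ_n`, `σ_n`, `Σ^λ_{j,l}`, `∏(λ-τ)⁻¹`, of the terms of (2.19), and of `μ̄_j`)
  with `hasDerivAt_tauDeriv`, `hasDerivAt_sigmaDeriv`, `hasDerivAt_lamLogDeriv`,
  `hasDerivAt_lamInvProdDeriv`, `hasDerivAt_mubarDerivTerm`;
* the bounds `abs_tauDeriv2_le`, `abs_sigmaDeriv2_le`, `abs_lamLogDeriv2_le`, `abs_lamInvProdDeriv2_le`,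
  `abs_mubarDerivTerm2_le` (all `O(·/g₀³)` with explicit polynomial constants);
* **`hasDerivAt_mubarDeriv`** (termwise differentiation of `μ̄_j'`, M-test with geometric majorant) and
  **`abs_mubarDeriv2_le`**: `|μ̄_j''| ≤ K_{μ,2}χ_jḡ_j²/g₀³`;
* **`hasDerivAt_flowDeriv`** — Lemma 2.3, second derivatives, for all three components, with (2.34).
-/

noncomputable section

open Filter Topology Set Finset
open scoped BigOperators

namespace Literature.Barriers.CriticalPhenomena

namespace CTWSAW

/-! ### Constants -/

/-- `K_{τ,2} = C(8B·C_{2,0} + K_{z,2})`, the constant of `|τ_n''| ≤ K_{τ,2}χ_nḡ_n²/g₀³`. [cite: BauerschmidtBrydgesSlade2015Flow, Lemma 2.3, (2.34)] -/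
def tauDeriv2Const (B C c20 : ℝ) : ℝ := C * (8 * B * c20 + zbarDeriv2Const B C c20)

/-- The constant of `|σ_n''| ≤ K_{σ,2}χ_nḡ_n²/g₀³`:
`C(16B·C_{2,0} + 2K_{z,2} + 2 + 4B·C_{2,0}·Z + 2K_z + 2K_z² + Z·K_{z,2})`, `Z = 2C·C_{2,0}`.
[cite: BauerschmidtBrydgesSlade2015Flow, Lemma 2.3, (2.34)] -/
def sigmaDeriv2Const (B C c20 : ℝ) : ℝ :=
  C * (16 * B * c20 + 2 * zbarDeriv2Const B C c20 + 2 + 4 * B * c20 * (2 * C * c20) +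
    2 * zDerivConst C c20 + 2 * zDerivConst C c20 ^ 2 + 2 * C * c20 * zbarDeriv2Const B C c20)

/-- The constant of `|(Σ^λ_{j,l})'| ≤ K_{R,2}χ_jḡ_j/g₀³`: `α(K_{τ,2} + α(C(1+K_z))²)C_{2,0}`.
[cite: BauerschmidtBrydgesSlade2015Flow, Lemma 2.3, (2.34)] -/
def lamLogDeriv2Const (B C c20 α : ℝ) : ℝ :=
  α * (tauDeriv2Const B C c20 + α * (C * (1 + zDerivConst C c20)) ^ 2) * c20

/-- The constant of `|(∏(λ-τ)⁻¹)''| ≤ K_{Λ,2}α^{l+1}χ_jḡ_j/g₀³`: `2(αC(1+K_z)C_{2,0})² + K_{R,2}`.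
[cite: BauerschmidtBrydgesSlade2015Flow, Lemma 2.3, (2.34)] -/
def lamInvProdDeriv2Const (B C c20 α : ℝ) : ℝ :=
  2 * (α * (C * (1 + zDerivConst C c20)) * c20) ^ 2 + lamLogDeriv2Const B C c20 α

/-- The constant of the termwise bound `|mubarDerivTerm2| ≤ K α^{l+1}χ_jḡ_j²/g₀³`:
`2K_{Λ,2}K_σ + 16α·C(1+K_z)·C_{2,0}·K_σ' + 4K_{σ,2}`. [cite: BauerschmidtBrydgesSlade2015Flow, Lemma 2.3, (2.34)] -/
def mubarDeriv2Const (B C c20 α : ℝ) : ℝ :=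
  2 * lamInvProdDeriv2Const B C c20 α * sigmaConst C c20 +
    16 * α * (C * (1 + zDerivConst C c20)) * c20 * sigmaDerivConst C c20 + 4 * sigmaDeriv2Const B C c20

/-- `K_{τ,2} ≥ 0`. [folklore] -/
theorem tauDeriv2Const_nonneg {B C c20 : ℝ} (hB : 0 ≤ B) (hC : 0 ≤ C) (hc : 0 ≤ c20) :
    0 ≤ tauDeriv2Const B C c20 := by
  have := zbarDeriv2Const_nonneg hB hC hc
  unfold tauDeriv2Const; positivity

/-- `K_{σ,2} ≥ 0`. [folklore] -/
theorem sigmaDeriv2Const_nonneg {B C c20 : ℝ} (hB : 0 ≤ B) (hC : 0 ≤ C) (hc : 0 ≤ c20) :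
    0 ≤ sigmaDeriv2Const B C c20 := by
  have := zbarDeriv2Const_nonneg hB hC hc
  have := zDerivConst_nonneg hC hc
  unfold sigmaDeriv2Const; positivity

/-- `K_{R,2} ≥ 0`. [folklore] -/
theorem lamLogDeriv2Const_nonneg {B C c20 α : ℝ} (hB : 0 ≤ B) (hC : 0 ≤ C) (hc : 0 ≤ c20) (hα : 0 ≤ α) :
    0 ≤ lamLogDeriv2Const B C c20 α := by
  have := tauDeriv2Const_nonneg hB hC hc
  unfold lamLogDeriv2Const; positivity

/-- `K_{Λ,2} ≥ 0`. [folklore] -/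
theorem lamInvProdDeriv2Const_nonneg {B C c20 α : ℝ} (hB : 0 ≤ B) (hC : 0 ≤ C) (hc : 0 ≤ c20) (hα : 0 ≤ α) :
    0 ≤ lamInvProdDeriv2Const B C c20 α := by
  have := lamLogDeriv2Const_nonneg hB hC hc hα
  unfold lamInvProdDeriv2Const; positivity

/-- `K_{μ,2}' ≥ 0`. [folklore] -/
theorem mubarDeriv2Const_nonneg {B C c20 α : ℝ} (hB : 0 ≤ B) (hC : 0 ≤ C) (hc : 0 ≤ c20) (hα : 0 ≤ α) :
    0 ≤ mubarDeriv2Const B C c20 α := by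
  have := lamInvProdDeriv2Const_nonneg hB hC hc hα
  have := sigmaConst_nonneg hC hc
  have := sigmaDerivConst_nonneg hC hc
  have := sigmaDeriv2Const_nonneg hB hC hc
  have := zDerivConst_nonneg hC hc
  unfold mubarDeriv2Const; positivity

/-! ### The second derivatives of `τ`, `σ`, `∏(λ-τ)⁻¹`, and of the terms of (2.19) -/

namespace QuadFlowParams

variable (P : QuadFlowParams) (g₀ : ℝ)

/-- `τ_n'' = υ^{gμ}_nḡ_n'' + υ^{zμ}_nz̄_n''`. [cite: BauerschmidtBrydgesSlade2015Flow, Lemma 2.3 (proof, μ̄_j'')] -/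
def tauDeriv2 (n : ℕ) : ℝ := P.υgμ n * gbarDeriv2 P.β g₀ n + P.υzμ n * P.zbarDeriv2 g₀ n

/-- `σ_n''` (the derivative of `sigmaDeriv`, term by term). [cite: BauerschmidtBrydgesSlade2015Flow, Lemma 2.3 (proof: "the leading behaviour can be seen from the z̄_j'' contribution to the σ_l'' term")] -/
def sigmaDeriv2 (n : ℕ) : ℝ :=
  P.η n * gbarDeriv2 P.β g₀ n + P.γ n * P.zbarDeriv2 g₀ n -
    P.υgg n * (2 * gbarDeriv P.β g₀ n * gbarDeriv P.β g₀ n + 2 * gbar P.β g₀ n * gbarDeriv2 P.β g₀ n) -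
    (P.υgz n * gbarDeriv2 P.β g₀ n * P.zbar g₀ n + P.υgz n * gbarDeriv P.β g₀ n * P.zbarDeriv g₀ n +
      (P.υgz n * gbarDeriv P.β g₀ n * P.zbarDeriv g₀ n + P.υgz n * gbar P.β g₀ n * P.zbarDeriv2 g₀ n)) -
    P.υzz n * (2 * P.zbarDeriv g₀ n * P.zbarDeriv g₀ n + 2 * P.zbar g₀ n * P.zbarDeriv2 g₀ n)

/-- `(Σ^λ_{j,l})' = Σ_i(τ_{i+j}''h_{i+j} + τ_{i+j}'·τ_{i+j}'h_{i+j}²)`, `h = (λ-τ)⁻¹`. [cite: BauerschmidtBrydgesSlade2015Flow, Lemma 2.3 (proof, μ̄_j'')] -/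
def lamLogDeriv2 (j l : ℕ) : ℝ :=
  ∑ i ∈ Finset.range (l + 1),
    (P.tauDeriv2 g₀ (i + j) * (P.lam (i + j) - P.tau g₀ (i + j))⁻¹ +
      P.tauDeriv g₀ (i + j) * (P.tauDeriv g₀ (i + j) * (P.lam (i + j) - P.tau g₀ (i + j))⁻¹ ^ 2))

/-- `(∏(λ-τ)⁻¹)'' = (∏(λ-τ)⁻¹)'Σ^λ + ∏(λ-τ)⁻¹(Σ^λ)'`. [cite: BauerschmidtBrydgesSlade2015Flow, Lemma 2.3 (proof, μ̄_j'')] -/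
def lamInvProdDeriv2 (j l : ℕ) : ℝ :=
  P.lamInvProdDeriv g₀ j l * P.lamLogDeriv g₀ j l + P.lamInvProd g₀ j l * P.lamLogDeriv2 g₀ j l

/-- The second termwise derivative of (2.19): `Λ''σ + Λ'σ' + (Λ'σ' + Λσ'')`. [cite: BauerschmidtBrydgesSlade2015Flow, Lemma 2.3 (proof, μ̄_j'')] -/
def mubarDerivTerm2 (j l : ℕ) : ℝ :=
  P.lamInvProdDeriv2 g₀ j l * P.sigma g₀ (l + j) + P.lamInvProdDeriv g₀ j l * P.sigmaDeriv g₀ (l + j) +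
    (P.lamInvProdDeriv g₀ j l * P.sigmaDeriv g₀ (l + j) + P.lamInvProd g₀ j l * P.sigmaDeriv2 g₀ (l + j))

/-- **`μ̄_j''`** (the derivative of `μ̄_j'`, termwise). [cite: BauerschmidtBrydgesSlade2015Flow, Lemma 2.3, (2.34)] -/
def mubarDeriv2 (j : ℕ) : ℝ := -∑' l, P.mubarDerivTerm2 g₀ j l

end QuadFlowParams

section

variable {P : QuadFlowParams} {Ω : ℝ} {k : ℕ∞} {B c : ℝ} {N : ℕ} {C lam b : ℝ}

/-- `τ_n'` is differentiable in `g₀ ∈ (0,b)` with derivative `tauDeriv2`. [cite: BauerschmidtBrydgesSlade2015Flow, Lemma 2.3 (proof, μ̄_j'')] -/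
theorem hasDerivAt_tauDeriv (hb : CutoffQuadHyp P Ω k B c N C lam b)
    (hsmall : 8 * B ^ 2 * ((1 + N) / c + N + 2 * Ω / (Ω - 1)) * b ≤ 1) {x : ℝ} (hx0 : 0 < x)
    (hxb : x < b) (n : ℕ) : HasDerivAt (fun y => P.tauDeriv y n) (P.tauDeriv2 x n) x := by
  have h1 := (hasDerivAt_gbarDeriv P.β n x).const_mul (P.υgμ n)
  have h2 := (hasDerivAt_zbarDeriv hb hsmall hx0 hxb n).const_mul (P.υzμ n)
  show HasDerivAt (fun y => P.υgμ n * gbarDeriv P.β y n + P.υzμ n * P.zbarDeriv y n)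
    (P.υgμ n * gbarDeriv2 P.β x n + P.υzμ n * P.zbarDeriv2 x n) x
  exact h1.add h2

/-- `σ_n'` is differentiable in `g₀ ∈ (0,b)` with derivative `sigmaDeriv2`. [cite: BauerschmidtBrydgesSlade2015Flow, Lemma 2.3 (proof, σ_l'')] -/
theorem hasDerivAt_sigmaDeriv (hb : CutoffQuadHyp P Ω k B c N C lam b)
    (hsmall : 8 * B ^ 2 * ((1 + N) / c + N + 2 * Ω / (Ω - 1)) * b ≤ 1) {x : ℝ} (hx0 : 0 < x)
    (hxb : x < b) (n : ℕ) : HasDerivAt (fun y => P.sigmaDeriv y n) (P.sigmaDeriv2 x n) x := by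
  have hg := hasDerivAt_gbar P.β n x
  have hD := hasDerivAt_gbarDeriv P.β n x
  have hz := hasDerivAt_zbar hb hsmall hx0 hxb n
  have hz' := hasDerivAt_zbarDeriv hb hsmall hx0 hxb n
  have t1 := hD.const_mul (P.η n)
  have t2 := hz'.const_mul (P.γ n)
  have t3 := (((hg.const_mul 2).mul hD)).const_mul (P.υgg n)
  have t4 := ((hD.const_mul (P.υgz n)).mul hz).add ((hg.const_mul (P.υgz n)).mul hz')
  have t5 := ((hz'.const_mul 2).mul hz').add ((hz.const_mul 2).mul hz') -- placeholder, unused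
  have t6 := (((hz.const_mul 2).mul hz')).const_mul (P.υzz n)
  clear t5
  show HasDerivAt (fun y => P.η n * gbarDeriv P.β y n + P.γ n * P.zbarDeriv y n -
      P.υgg n * (2 * gbar P.β y n * gbarDeriv P.β y n) -
      (P.υgz n * gbarDeriv P.β y n * P.zbar y n + P.υgz n * gbar P.β y n * P.zbarDeriv y n) -
      P.υzz n * (2 * P.zbar y n * P.zbarDeriv y n)) (P.sigmaDeriv2 x n) x
  refine ((((t1.add t2).sub t3).sub t4).sub t6).congr_deriv ?_
  simp only [QuadFlowParams.sigmaDeriv2]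

/-- `Σ^λ_{j,l}` is differentiable in `g₀ ∈ (0,b)` with derivative `lamLogDeriv2`. [cite: BauerschmidtBrydgesSlade2015Flow, Lemma 2.3 (proof, μ̄_j'')] -/
theorem hasDerivAt_lamLogDeriv (hb : CutoffQuadHyp P Ω k B c N C lam b)
    (hsmall : 8 * B ^ 2 * ((1 + N) / c + N + 2 * Ω / (Ω - 1)) * b ≤ 1) {x : ℝ} (hx0 : 0 < x)
    (hxb : x < b) (j l : ℕ) : HasDerivAt (fun y => P.lamLogDeriv y j l) (P.lamLogDeriv2 x j l) x := by
  unfold QuadFlowParams.lamLogDeriv QuadFlowParams.lamLogDeriv2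
  refine HasDerivAt.fun_sum fun i _ => ?_
  exact (hasDerivAt_tauDeriv hb hsmall hx0 hxb (i + j)).mul (hasDerivAt_inv_lam_sub_tau hb hsmall hx0 hxb (i + j))

/-- `(∏(λ-τ)⁻¹)'` is differentiable in `g₀ ∈ (0,b)` with derivative `lamInvProdDeriv2`. [cite: BauerschmidtBrydgesSlade2015Flow, Lemma 2.3 (proof, μ̄_j'')] -/
theorem hasDerivAt_lamInvProdDeriv (hb : CutoffQuadHyp P Ω k B c N C lam b)
    (hsmall : 8 * B ^ 2 * ((1 + N) / c + N + 2 * Ω / (Ω - 1)) * b ≤ 1) {x : ℝ} (hx0 : 0 < x)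
    (hxb : x < b) (j l : ℕ) :
    HasDerivAt (fun y => P.lamInvProdDeriv y j l) (P.lamInvProdDeriv2 x j l) x := by
  unfold QuadFlowParams.lamInvProdDeriv QuadFlowParams.lamInvProdDeriv2
  exact (hasDerivAt_lamInvProd hb hsmall hx0 hxb j l).mul (hasDerivAt_lamLogDeriv hb hsmall hx0 hxb j l)

/-- The termwise derivative of (2.19) is differentiable in `g₀ ∈ (0,b)` with derivative
`mubarDerivTerm2`. [cite: BauerschmidtBrydgesSlade2015Flow, Lemma 2.3 (proof, μ̄_j'')] -/
theorem hasDerivAt_mubarDerivTerm (hb : CutoffQuadHyp P Ω k B c N C lam b)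
    (hsmall : 8 * B ^ 2 * ((1 + N) / c + N + 2 * Ω / (Ω - 1)) * b ≤ 1) {x : ℝ} (hx0 : 0 < x)
    (hxb : x < b) (j l : ℕ) :
    HasDerivAt (fun y => P.mubarDerivTerm y j l) (P.mubarDerivTerm2 x j l) x := by
  have h1 := hasDerivAt_lamInvProdDeriv hb hsmall hx0 hxb j l
  have h2 := hasDerivAt_sigma hb hsmall hx0 hxb (l + j)
  have h3 := hasDerivAt_lamInvProd hb hsmall hx0 hxb j l
  have h4 := hasDerivAt_sigmaDeriv hb hsmall hx0 hxb (l + j)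
  unfold QuadFlowParams.mubarDerivTerm QuadFlowParams.mubarDerivTerm2
  exact (h1.mul h2).add (h3.mul h4)

/-! #### Bounds at a point -/

namespace CutoffQuadHyp

variable {g₀ : ℝ} (h : CutoffQuadHyp P Ω k B c N C lam g₀)
include h

/-- **`|τ_n''| ≤ K_{τ,2}χ_nḡ_n²/g₀³`.** [cite: BauerschmidtBrydgesSlade2015Flow, Lemma 2.3, (2.34)] -/
theorem abs_tauDeriv2_le (hsmall : 8 * B ^ 2 * ((1 + N) / c + N + 2 * Ω / (Ω - 1)) * g₀ ≤ 1) (n : ℕ) :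
    |P.tauDeriv2 g₀ n| ≤ tauDeriv2Const B C ((1 + N) / c + N + 2 * Ω / (Ω - 1)) *
      (cutoffWeight Ω k n * gbar P.β g₀ n ^ 2) / g₀ ^ 3 := by
  have hG := h.toCutoffGbarHyp
  have hg := hG.g₀_pos
  have hC := h.C_nonneg
  have hB := hG.B_nonneg
  have hC20 := hG.C20_nonneg
  have hw := (hG.weight_pos n).le
  have hw1 := hG.weight_le_one n
  have hgn := (hG.gbar_pos n).le
  have hE := hG.abs_gbarDeriv2_le hsmall n
  have hz2 := h.abs_zbarDeriv2_le hsmall n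
  set c20 : ℝ := (1 + N) / c + N + 2 * Ω / (Ω - 1) with hc20
  have hKz2 := zbarDeriv2Const_nonneg hB hC hC20
  set G3 : ℝ := cutoffWeight Ω k n * gbar P.β g₀ n ^ 2 / g₀ ^ 3 with hG3
  have hG30 : 0 ≤ G3 := by positivity
  have t1 : |P.υgμ n * gbarDeriv2 P.β g₀ n| ≤ 8 * B * c20 * (C * G3) := by
    rw [abs_mul]
    calc |P.υgμ n| * |gbarDeriv2 P.β g₀ n| ≤ (C * cutoffWeight Ω k n) * (8 * B * c20 * gbar P.β g₀ n ^ 2 / g₀ ^ 3) :=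
          mul_le_mul (h.υgμ_le n) hE (abs_nonneg _) (mul_nonneg hC hw)
      _ = 8 * B * c20 * (C * G3) := by rw [hG3]; ring
  have t2 : |P.υzμ n * P.zbarDeriv2 g₀ n| ≤ zbarDeriv2Const B C c20 * (C * G3) := by
    rw [abs_mul]
    calc |P.υzμ n| * |P.zbarDeriv2 g₀ n|
        ≤ (C * cutoffWeight Ω k n) * (zbarDeriv2Const B C c20 * (cutoffWeight Ω k n * gbar P.β g₀ n ^ 2) / g₀ ^ 3) :=
          mul_le_mul (h.υzμ_le n) hz2 (abs_nonneg _) (mul_nonneg hC hw)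
      _ = cutoffWeight Ω k n * (zbarDeriv2Const B C c20 * (C * G3)) := by rw [hG3]; ring
      _ ≤ 1 * (zbarDeriv2Const B C c20 * (C * G3)) := mul_le_mul_of_nonneg_right hw1 (by positivity)
      _ = _ := one_mul _
  unfold QuadFlowParams.tauDeriv2
  calc |P.υgμ n * gbarDeriv2 P.β g₀ n + P.υzμ n * P.zbarDeriv2 g₀ n|
      ≤ 8 * B * c20 * (C * G3) + zbarDeriv2Const B C c20 * (C * G3) := abs_add_le_of_le' t1 t2
    _ = tauDeriv2Const B C c20 * (cutoffWeight Ω k n * gbar P.β g₀ n ^ 2) / g₀ ^ 3 := by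
        rw [hG3, tauDeriv2Const]; ring

set_option maxHeartbeats 800000 in
/-- **`|σ_n''| ≤ K_{σ,2}χ_nḡ_n²/g₀³`** (ten products, each `O(χ_nḡ_n²/g₀³)` by `ḡ_n² ≤ g₀`, `ḡ_n ≤ ½`,
`χ_n ≤ 1` and the bounds for `ḡ', ḡ'', z̄, z̄', z̄''`). [cite: BauerschmidtBrydgesSlade2015Flow, Lemma 2.3, (2.34) (σ_l'')] -/
theorem abs_sigmaDeriv2_le (hsmall : 8 * B ^ 2 * ((1 + N) / c + N + 2 * Ω / (Ω - 1)) * g₀ ≤ 1) (n : ℕ) :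
    |P.sigmaDeriv2 g₀ n| ≤ sigmaDeriv2Const B C ((1 + N) / c + N + 2 * Ω / (Ω - 1)) *
      (cutoffWeight Ω k n * gbar P.β g₀ n ^ 2) / g₀ ^ 3 := by
  have hG := h.toCutoffGbarHyp
  have hg := hG.g₀_pos
  have hC := h.C_nonneg
  have hB := hG.B_nonneg
  have hC20 := hG.C20_nonneg
  have hw := (hG.weight_pos n).le
  have hw1 := hG.weight_le_one n
  have hgn := (hG.gbar_pos n).le
  have hg12 := hG.gbar_le_half n
  have hgn2 := hG.gbar_le_two_mul_init n
  have hd := hG.abs_gbarDeriv_le hsmall n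
  have hE := hG.abs_gbarDeriv2_le hsmall n
  have hz := h.abs_zbar_le n
  have hz1 := h.abs_zbarDeriv_le' hsmall n
  have hz2 := h.abs_zbarDeriv2_le hsmall n
  set c20 : ℝ := (1 + N) / c + N + 2 * Ω / (Ω - 1) with hc20
  set Kz : ℝ := zDerivConst C c20 with hKz
  set Kz2 : ℝ := zbarDeriv2Const B C c20 with hKz2def
  set Z : ℝ := 2 * C * c20 with hZ
  have hKz0 : 0 ≤ Kz := zDerivConst_nonneg hC hC20
  have hKz20 : 0 ≤ Kz2 := zbarDeriv2Const_nonneg hB hC hC20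
  have hZ0 : 0 ≤ Z := by positivity
  unfold QuadFlowParams.sigmaDeriv2
  -- abbreviations and elementary sizes
  set gn : ℝ := gbar P.β g₀ n with hgn_def
  set wn : ℝ := cutoffWeight Ω k n with hwn_def
  set G3 : ℝ := wn * gn ^ 2 / g₀ ^ 3 with hG3
  have hG30 : 0 ≤ G3 := by positivity
  have hsq : gn ^ 2 ≤ g₀ := by nlinarith
  have hsq' : gn ^ 2 / g₀ ≤ 1 := by rwa [div_le_one hg]
  have hd' : |gbarDeriv P.β g₀ n| ≤ gn ^ 2 / g₀ ^ 2 := by rwa [div_pow] at hd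
  have hzB : |P.zbar g₀ n| ≤ Z * (wn * gn) := hz
  have hz1' : |P.zbarDeriv g₀ n| ≤ Kz * (wn * gn ^ 2) / g₀ ^ 2 := hz1
  have hz2' : |P.zbarDeriv2 g₀ n| ≤ Kz2 * (wn * gn ^ 2) / g₀ ^ 3 := hz2
  -- weaker forms without the weight (`wn ≤ 1`)
  have hz1w : |P.zbarDeriv g₀ n| ≤ Kz * gn ^ 2 / g₀ ^ 2 := by
    refine hz1'.trans (div_le_div_of_nonneg_right ?_ (by positivity))
    exact mul_le_mul_of_nonneg_left (mul_le_of_le_one_left (sq_nonneg _) hw1) hKz0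
  have hzBw : |P.zbar g₀ n| ≤ Z * gn :=
    hzB.trans (mul_le_mul_of_nonneg_left (mul_le_of_le_one_left hgn hw1) hZ0)
  -- the coefficient bounds, with and without the weight
  have hcoef : ∀ {u : ℝ}, |u| ≤ C * wn → |u| ≤ C := fun hu => hu.trans (mul_le_of_le_one_right hC hw1)
  -- ten atomic products, each `≤ (number) · (C·G3)`
  have a1 : |P.η n * gbarDeriv2 P.β g₀ n| ≤ 8 * B * c20 * (C * G3) := by
    rw [abs_mul]
    calc |P.η n| * |gbarDeriv2 P.β g₀ n| ≤ (C * wn) * (8 * B * c20 * gn ^ 2 / g₀ ^ 3) :=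
          mul_le_mul (h.eta_le n) hE (abs_nonneg _) (mul_nonneg hC hw)
      _ = 8 * B * c20 * (C * G3) := by rw [hG3]; ring
  have a2 : |P.γ n * P.zbarDeriv2 g₀ n| ≤ Kz2 * (C * G3) := by
    rw [abs_mul]
    calc |P.γ n| * |P.zbarDeriv2 g₀ n| ≤ C * (Kz2 * (wn * gn ^ 2) / g₀ ^ 3) :=
          mul_le_mul (hcoef (h.gamma_le n)) hz2' (abs_nonneg _) hC
      _ = Kz2 * (C * G3) := by rw [hG3]; ring
  have a3 : |P.υgg n * (2 * gbarDeriv P.β g₀ n * gbarDeriv P.β g₀ n + 2 * gn * gbarDeriv2 P.β g₀ n)| ≤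
      (2 + 8 * B * c20) * (C * G3) := by
    rw [abs_mul]
    have i1 : |2 * gbarDeriv P.β g₀ n * gbarDeriv P.β g₀ n| ≤ 2 * (gn ^ 2 / g₀ ^ 2) * (gn ^ 2 / g₀ ^ 2) := by
      rw [abs_mul, abs_mul, abs_two]
      exact mul_le_mul (mul_le_mul_of_nonneg_left hd' zero_le_two) hd' (abs_nonneg _) (by positivity)
    have i2 : |2 * gn * gbarDeriv2 P.β g₀ n| ≤ 2 * gn * (8 * B * c20 * gn ^ 2 / g₀ ^ 3) := by
      rw [abs_mul, abs_of_nonneg (by positivity : (0 : ℝ) ≤ 2 * gn)]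
      exact mul_le_mul_of_nonneg_left hE (by positivity)
    calc |P.υgg n| * |2 * gbarDeriv P.β g₀ n * gbarDeriv P.β g₀ n + 2 * gn * gbarDeriv2 P.β g₀ n|
        ≤ (C * wn) * (2 * (gn ^ 2 / g₀ ^ 2) * (gn ^ 2 / g₀ ^ 2) + 2 * gn * (8 * B * c20 * gn ^ 2 / g₀ ^ 3)) :=
          mul_le_mul (h.υgg_le n) (abs_add_le_of_le' i1 i2) (abs_nonneg _) (mul_nonneg hC hw)
      _ = (2 * (gn ^ 2 / g₀) + 16 * B * c20 * gn) * (C * G3) := by rw [hG3]; field_simp; ring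
      _ ≤ (2 * 1 + 16 * B * c20 * (1 / 2)) * (C * G3) := by gcongr
      _ = (2 + 8 * B * c20) * (C * G3) := by ring
  have a4 : |P.υgz n * gbarDeriv2 P.β g₀ n * P.zbar g₀ n| ≤ 4 * B * c20 * Z * (C * G3) := by
    rw [abs_mul, abs_mul]
    calc |P.υgz n| * |gbarDeriv2 P.β g₀ n| * |P.zbar g₀ n|
        ≤ C * (8 * B * c20 * gn ^ 2 / g₀ ^ 3) * (Z * (wn * gn)) :=
          mul_le_mul (mul_le_mul (hcoef (h.υgz_le n)) hE (abs_nonneg _) hC) hzB (abs_nonneg _) (by positivity)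
      _ = (8 * B * c20 * Z * gn) * (C * G3) := by rw [hG3]; ring
      _ ≤ (8 * B * c20 * Z * (1 / 2)) * (C * G3) := by gcongr
      _ = _ := by ring
  have a5 : |P.υgz n * gbarDeriv P.β g₀ n * P.zbarDeriv g₀ n| ≤ Kz * (C * G3) := by
    rw [abs_mul, abs_mul]
    calc |P.υgz n| * |gbarDeriv P.β g₀ n| * |P.zbarDeriv g₀ n|
        ≤ C * (gn ^ 2 / g₀ ^ 2) * (Kz * (wn * gn ^ 2) / g₀ ^ 2) :=
          mul_le_mul (mul_le_mul (hcoef (h.υgz_le n)) hd' (abs_nonneg _) hC) hz1' (abs_nonneg _) (by positivity)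
      _ = (Kz * (gn ^ 2 / g₀)) * (C * G3) := by rw [hG3]; field_simp
      _ ≤ (Kz * 1) * (C * G3) := by gcongr
      _ = _ := by ring
  have a6 : |P.υgz n * gn * P.zbarDeriv2 g₀ n| ≤ Kz2 / 2 * (C * G3) := by
    rw [abs_mul, abs_mul, abs_of_nonneg hgn]
    calc |P.υgz n| * gn * |P.zbarDeriv2 g₀ n| ≤ C * (1 / 2) * (Kz2 * (wn * gn ^ 2) / g₀ ^ 3) :=
          mul_le_mul (mul_le_mul (hcoef (h.υgz_le n)) hg12 hgn hC) hz2' (abs_nonneg _) (by positivity)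
      _ = Kz2 / 2 * (C * G3) := by rw [hG3]; ring
  have a7 : |P.υzz n * (2 * P.zbarDeriv g₀ n * P.zbarDeriv g₀ n + 2 * P.zbar g₀ n * P.zbarDeriv2 g₀ n)| ≤
      (2 * Kz ^ 2 + Z * Kz2) * (C * G3) := by
    rw [abs_mul]
    have i1 : |2 * P.zbarDeriv g₀ n * P.zbarDeriv g₀ n| ≤ 2 * (Kz * gn ^ 2 / g₀ ^ 2) * (Kz * (wn * gn ^ 2) / g₀ ^ 2) := by
      rw [abs_mul, abs_mul, abs_two]
      exact mul_le_mul (mul_le_mul_of_nonneg_left hz1w zero_le_two) hz1' (abs_nonneg _) (by positivity)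
    have i2 : |2 * P.zbar g₀ n * P.zbarDeriv2 g₀ n| ≤ 2 * (Z * gn) * (Kz2 * (wn * gn ^ 2) / g₀ ^ 3) := by
      rw [abs_mul, abs_mul, abs_two]
      exact mul_le_mul (mul_le_mul_of_nonneg_left hzBw zero_le_two) hz2' (abs_nonneg _) (by positivity)
    calc |P.υzz n| * |2 * P.zbarDeriv g₀ n * P.zbarDeriv g₀ n + 2 * P.zbar g₀ n * P.zbarDeriv2 g₀ n|
        ≤ C * (2 * (Kz * gn ^ 2 / g₀ ^ 2) * (Kz * (wn * gn ^ 2) / g₀ ^ 2) +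
            2 * (Z * gn) * (Kz2 * (wn * gn ^ 2) / g₀ ^ 3)) :=
          mul_le_mul (hcoef (h.υzz_le n)) (abs_add_le_of_le' i1 i2) (abs_nonneg _) hC
      _ = (2 * Kz ^ 2 * (gn ^ 2 / g₀) + 2 * Z * Kz2 * gn) * (C * G3) := by rw [hG3]; field_simp
      _ ≤ (2 * Kz ^ 2 * 1 + 2 * Z * Kz2 * (1 / 2)) * (C * G3) := by gcongr
      _ = _ := by ring
  calc |P.η n * gbarDeriv2 P.β g₀ n + P.γ n * P.zbarDeriv2 g₀ n -
        P.υgg n * (2 * gbarDeriv P.β g₀ n * gbarDeriv P.β g₀ n + 2 * gn * gbarDeriv2 P.β g₀ n) -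
        (P.υgz n * gbarDeriv2 P.β g₀ n * P.zbar g₀ n + P.υgz n * gbarDeriv P.β g₀ n * P.zbarDeriv g₀ n +
          (P.υgz n * gbarDeriv P.β g₀ n * P.zbarDeriv g₀ n + P.υgz n * gn * P.zbarDeriv2 g₀ n)) -
        P.υzz n * (2 * P.zbarDeriv g₀ n * P.zbarDeriv g₀ n + 2 * P.zbar g₀ n * P.zbarDeriv2 g₀ n)|
      ≤ 8 * B * c20 * (C * G3) + Kz2 * (C * G3) + (2 + 8 * B * c20) * (C * G3) +
          (4 * B * c20 * Z * (C * G3) + Kz * (C * G3) + (Kz * (C * G3) + Kz2 / 2 * (C * G3))) +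
          (2 * Kz ^ 2 + Z * Kz2) * (C * G3) :=
        abs_sub_le_of_le' (abs_sub_le_of_le' (abs_sub_le_of_le' (abs_add_le_of_le' a1 a2) a3)
          (abs_add_le_of_le' (abs_add_le_of_le' a4 a5) (abs_add_le_of_le' a5 a6))) a7
    _ ≤ sigmaDeriv2Const B C c20 * (wn * gn ^ 2) / g₀ ^ 3 := by
        rw [sigmaDeriv2Const, ← hKz, ← hKz2def, ← hZ]
        have hCG : 0 ≤ C * G3 := by positivity
        have e : C * (16 * B * c20 + 2 * Kz2 + 2 + 4 * B * c20 * Z + 2 * Kz + 2 * Kz ^ 2 + Z * Kz2) * (wn * gn ^ 2) / g₀ ^ 3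
            = (16 * B * c20 + 2 * Kz2 + 2 + 4 * B * c20 * Z + 2 * Kz + 2 * Kz ^ 2 + Z * Kz2) * (C * G3) := by
          rw [hG3]; ring
        rw [e]
        linarith [mul_nonneg hKz20 hCG]

/-- **`|(Σ^λ_{j,l})'| ≤ K_{R,2}χ_jḡ_j/g₀³`.** [cite: BauerschmidtBrydgesSlade2015Flow, Lemma 2.3, (2.34)] -/
theorem abs_lamLogDeriv2_le (hsmall : 8 * B ^ 2 * ((1 + N) / c + N + 2 * Ω / (Ω - 1)) * g₀ ≤ 1) (j l : ℕ) :
    |P.lamLogDeriv2 g₀ j l| ≤ lamLogDeriv2Const B C ((1 + N) / c + N + 2 * Ω / (Ω - 1)) (2 / (1 + lam)) *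
      (cutoffWeight Ω k j * gbar P.β g₀ j) / g₀ ^ 3 := by
  have hG := h.toCutoffGbarHyp
  have hg := hG.g₀_pos
  have hC := h.C_nonneg
  have hB := hG.B_nonneg
  have hC20 := hG.C20_nonneg
  obtain ⟨hα0, -⟩ := h.alpha_mem
  have hsumsq := hG.sum_weight_mul_gbar_sq_le j (j + l)
  set c20 : ℝ := (1 + N) / c + N + 2 * Ω / (Ω - 1) with hc20
  set α : ℝ := 2 / (1 + lam) with hα
  set Kτ : ℝ := C * (1 + zDerivConst C c20) with hKτ
  set Kτ2 : ℝ := tauDeriv2Const B C c20 with hKτ2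
  have hKτ0 : 0 ≤ Kτ := by have := zDerivConst_nonneg hC hC20; positivity
  have hKτ20 : 0 ≤ Kτ2 := tauDeriv2Const_nonneg hB hC hC20
  have hterm : ∀ i, |P.tauDeriv2 g₀ (i + j) * (P.lam (i + j) - P.tau g₀ (i + j))⁻¹ +
      P.tauDeriv g₀ (i + j) * (P.tauDeriv g₀ (i + j) * (P.lam (i + j) - P.tau g₀ (i + j))⁻¹ ^ 2)| ≤
      α * (Kτ2 + α * Kτ ^ 2) / g₀ ^ 3 * (cutoffWeight Ω k (i + j) * gbar P.β g₀ (i + j) ^ 2) := by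
    intro i
    obtain ⟨hf0, hfα⟩ := h.inv_lam_sub_tau_mem (i + j)
    have ht := h.abs_tauDeriv_le hsmall (i + j)
    have ht2 := h.abs_tauDeriv2_le hsmall (i + j)
    have hw := (hG.weight_pos (i + j)).le
    have hw1 := hG.weight_le_one (i + j)
    have hgn := (hG.gbar_pos (i + j)).le
    have hg12 := hG.gbar_le_half (i + j)
    have hgn2 := hG.gbar_le_two_mul_init (i + j)
    have hsq : gbar P.β g₀ (i + j) ^ 2 ≤ g₀ := by nlinarith
    set X2 : ℝ := cutoffWeight Ω k (i + j) * gbar P.β g₀ (i + j) ^ 2 with hX2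
    have hX20 : 0 ≤ X2 := by positivity
    have t1 : |P.tauDeriv2 g₀ (i + j) * (P.lam (i + j) - P.tau g₀ (i + j))⁻¹| ≤ (Kτ2 * X2 / g₀ ^ 3) * α := by
      rw [abs_mul, abs_of_nonneg hf0]
      exact mul_le_mul ht2 hfα hf0 (by positivity)
    have t2 : |P.tauDeriv g₀ (i + j) * (P.tauDeriv g₀ (i + j) * (P.lam (i + j) - P.tau g₀ (i + j))⁻¹ ^ 2)| ≤
        (Kτ * X2 / g₀ ^ 2) * ((Kτ * X2 / g₀ ^ 2) * α ^ 2) := by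
      rw [abs_mul, abs_mul, abs_pow, abs_of_nonneg hf0]
      exact mul_le_mul ht (mul_le_mul ht (pow_le_pow_left₀ hf0 hfα 2) (by positivity) (by positivity))
        (by positivity) (by positivity)
    refine (abs_add_le_of_le' t1 t2).trans ?_
    have e : (Kτ2 * X2 / g₀ ^ 3) * α + (Kτ * X2 / g₀ ^ 2) * ((Kτ * X2 / g₀ ^ 2) * α ^ 2) =
        α * (Kτ2 + α * Kτ ^ 2 * (X2 / g₀)) / g₀ ^ 3 * X2 := by
      field_simp
    rw [e]
    have hx : X2 / g₀ ≤ 1 := by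
      rw [div_le_one hg, hX2]
      calc cutoffWeight Ω k (i + j) * gbar P.β g₀ (i + j) ^ 2 ≤ 1 * g₀ := mul_le_mul hw1 hsq (sq_nonneg _) zero_le_one
        _ = g₀ := one_mul _
    refine mul_le_mul_of_nonneg_right (div_le_div_of_nonneg_right (mul_le_mul_of_nonneg_left ?_ hα0) (by positivity)) hX20
    nlinarith [mul_nonneg (mul_nonneg hα0 (sq_nonneg Kτ)) (sub_nonneg.2 hx)]
  unfold QuadFlowParams.lamLogDeriv2
  calc |∑ i ∈ Finset.range (l + 1), (P.tauDeriv2 g₀ (i + j) * (P.lam (i + j) - P.tau g₀ (i + j))⁻¹ +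
        P.tauDeriv g₀ (i + j) * (P.tauDeriv g₀ (i + j) * (P.lam (i + j) - P.tau g₀ (i + j))⁻¹ ^ 2))|
      ≤ ∑ i ∈ Finset.range (l + 1), |P.tauDeriv2 g₀ (i + j) * (P.lam (i + j) - P.tau g₀ (i + j))⁻¹ +
        P.tauDeriv g₀ (i + j) * (P.tauDeriv g₀ (i + j) * (P.lam (i + j) - P.tau g₀ (i + j))⁻¹ ^ 2)| :=
        Finset.abs_sum_le_sum_abs _ _
    _ ≤ ∑ i ∈ Finset.range (l + 1), α * (Kτ2 + α * Kτ ^ 2) / g₀ ^ 3 *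
          (cutoffWeight Ω k (i + j) * gbar P.β g₀ (i + j) ^ 2) := Finset.sum_le_sum fun i _ => hterm i
    _ = α * (Kτ2 + α * Kτ ^ 2) / g₀ ^ 3 * ∑ m ∈ Finset.Icc j (j + l), cutoffWeight Ω k m * gbar P.β g₀ m ^ 2 := by
        rw [← Finset.mul_sum, sum_range_shift_eq_sum_Icc (fun m => cutoffWeight Ω k m * gbar P.β g₀ m ^ 2)]
    _ ≤ α * (Kτ2 + α * Kτ ^ 2) / g₀ ^ 3 * (c20 * (cutoffWeight Ω k j * gbar P.β g₀ j)) :=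
        mul_le_mul_of_nonneg_left hsumsq (by positivity)
    _ = _ := by rw [lamLogDeriv2Const, ← hKτ2, ← hKτ]; ring

/-- **`|(∏_{k=j}^{j+l}(λ_k - τ_k)⁻¹)''| ≤ K_{Λ,2}α^{l+1}χ_jḡ_j/g₀³`.** [cite: BauerschmidtBrydgesSlade2015Flow, Lemma 2.3, (2.34)] -/
theorem abs_lamInvProdDeriv2_le (hsmall : 8 * B ^ 2 * ((1 + N) / c + N + 2 * Ω / (Ω - 1)) * g₀ ≤ 1) (j l : ℕ) :
    |P.lamInvProdDeriv2 g₀ j l| ≤ (2 / (1 + lam)) ^ (l + 1) *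
      (lamInvProdDeriv2Const B C ((1 + N) / c + N + 2 * Ω / (Ω - 1)) (2 / (1 + lam)) *
        (cutoffWeight Ω k j * gbar P.β g₀ j) / g₀ ^ 3) := by
  have hG := h.toCutoffGbarHyp
  have hg := hG.g₀_pos
  have hC := h.C_nonneg
  have hB := hG.B_nonneg
  have hC20 := hG.C20_nonneg
  obtain ⟨hα0, -⟩ := h.alpha_mem
  obtain ⟨hP0, hP1⟩ := h.lamInvProd_mem j l
  have hΛ' := h.abs_lamInvProdDeriv_le hsmall j l
  have hR := h.abs_lamLogDeriv_le hsmall j l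
  have hR' := h.abs_lamLogDeriv2_le hsmall j l
  have hwj := (hG.weight_pos j).le
  have hwj1 := hG.weight_le_one j
  have hgj := (hG.gbar_pos j).le
  have hgj2 := hG.gbar_le_two_mul_init j
  set c20 : ℝ := (1 + N) / c + N + 2 * Ω / (Ω - 1) with hc20
  set α : ℝ := 2 / (1 + lam) with hα
  set Kτ : ℝ := C * (1 + zDerivConst C c20) with hKτ
  set X : ℝ := cutoffWeight Ω k j * gbar P.β g₀ j with hX
  have hX0 : 0 ≤ X := by positivity
  have hKτ0 : 0 ≤ Kτ := by have := zDerivConst_nonneg hC hC20; positivity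
  have hKR2 := lamLogDeriv2Const_nonneg hB hC hC20 hα0
  have hXg : X / g₀ ≤ 2 := by
    rw [div_le_iff₀ hg, hX]
    calc cutoffWeight Ω k j * gbar P.β g₀ j ≤ 1 * (2 * g₀) := mul_le_mul hwj1 hgj2 hgj zero_le_one
      _ = 2 * g₀ := one_mul _
  unfold QuadFlowParams.lamInvProdDeriv2
  have t1 : |P.lamInvProdDeriv g₀ j l * P.lamLogDeriv g₀ j l| ≤
      (α ^ (l + 1) * (α * Kτ * c20 * X / g₀ ^ 2)) * (α * Kτ * c20 * X / g₀ ^ 2) := by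
    rw [abs_mul]; exact mul_le_mul hΛ' hR (abs_nonneg _) (by positivity)
  have t2 : |P.lamInvProd g₀ j l * P.lamLogDeriv2 g₀ j l| ≤
      α ^ (l + 1) * (lamLogDeriv2Const B C c20 α * X / g₀ ^ 3) := by
    rw [abs_mul, abs_of_nonneg hP0]; exact mul_le_mul hP1 hR' (abs_nonneg _) (pow_nonneg hα0 _)
  refine (abs_add_le_of_le' t1 t2).trans ?_
  have e : (α ^ (l + 1) * (α * Kτ * c20 * X / g₀ ^ 2)) * (α * Kτ * c20 * X / g₀ ^ 2) +
      α ^ (l + 1) * (lamLogDeriv2Const B C c20 α * X / g₀ ^ 3) =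
      α ^ (l + 1) * (((α * Kτ * c20) ^ 2 * (X / g₀) + lamLogDeriv2Const B C c20 α) * X / g₀ ^ 3) := by
    field_simp
  rw [e, lamInvProdDeriv2Const, ← hKτ]
  refine mul_le_mul_of_nonneg_left (div_le_div_of_nonneg_right (mul_le_mul_of_nonneg_right ?_ hX0)
    (by positivity)) (pow_nonneg hα0 _)
  nlinarith [mul_nonneg (sq_nonneg (α * Kτ * c20)) (sub_nonneg.2 hXg)]

set_option maxHeartbeats 800000 in
/-- **Termwise bound for `μ̄_j''`**: `|mubarDerivTerm2| ≤ K α^{l+1}χ_jḡ_j²/g₀³`, `K = mubarDeriv2Const`.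
[cite: BauerschmidtBrydgesSlade2015Flow, Lemma 2.3, (2.34)] -/
theorem abs_mubarDerivTerm2_le (hsmall : 8 * B ^ 2 * ((1 + N) / c + N + 2 * Ω / (Ω - 1)) * g₀ ≤ 1) (j l : ℕ) :
    |P.mubarDerivTerm2 g₀ j l| ≤
      mubarDeriv2Const B C ((1 + N) / c + N + 2 * Ω / (Ω - 1)) (2 / (1 + lam)) * (2 / (1 + lam)) ^ (l + 1) *
        (cutoffWeight Ω k j * gbar P.β g₀ j ^ 2) / g₀ ^ 3 := by
  have hG := h.toCutoffGbarHyp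
  have hg := hG.g₀_pos
  have hC := h.C_nonneg
  have hB := hG.B_nonneg
  have hC20 := hG.C20_nonneg
  obtain ⟨hα0, -⟩ := h.alpha_mem
  obtain ⟨hP0, hP1⟩ := h.lamInvProd_mem j l
  have hΛ'' := h.abs_lamInvProdDeriv2_le hsmall j l
  have hΛ' := h.abs_lamInvProdDeriv_le hsmall j l
  have hσ' := h.abs_sigmaDeriv_le hsmall (l + j)
  have hσ'' := h.abs_sigmaDeriv2_le hsmall (l + j)
  obtain ⟨hs1, hs2⟩ := h.weight_gbar_shift_le j l
  have hwj := (hG.weight_pos j).le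
  have hwj1 := hG.weight_le_one j
  have hgj := (hG.gbar_pos j).le
  have hgj2 := hG.gbar_le_two_mul_init j
  set c20 : ℝ := (1 + N) / c + N + 2 * Ω / (Ω - 1) with hc20
  set α : ℝ := 2 / (1 + lam) with hα
  set Kτ : ℝ := C * (1 + zDerivConst C c20) with hKτ
  set KΛ2 : ℝ := lamInvProdDeriv2Const B C c20 α with hKΛ2
  have hKτ0 : 0 ≤ Kτ := by have := zDerivConst_nonneg hC hC20; positivity
  have hKΛ20 : 0 ≤ KΛ2 := lamInvProdDeriv2Const_nonneg hB hC hC20 hα0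
  have hKσ := sigmaConst_nonneg hC hC20
  have hKσ' := sigmaDerivConst_nonneg hC hC20
  have hKσ2 := sigmaDeriv2Const_nonneg hB hC hC20
  have hσ : |P.sigma g₀ (l + j)| ≤ sigmaConst C c20 * (cutoffWeight Ω k (l + j) * gbar P.β g₀ (l + j)) :=
    h.abs_sigma_le (l + j)
  unfold QuadFlowParams.mubarDerivTerm2
  set X : ℝ := cutoffWeight Ω k j * gbar P.β g₀ j with hX
  set X2 : ℝ := cutoffWeight Ω k j * gbar P.β g₀ j ^ 2 with hX2
  have hX0 : 0 ≤ X := by positivity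
  have hX20 : 0 ≤ X2 := by positivity
  have hXX : X ^ 2 ≤ X2 := by
    rw [hX, hX2]
    calc (cutoffWeight Ω k j * gbar P.β g₀ j) ^ 2 = cutoffWeight Ω k j * (cutoffWeight Ω k j * gbar P.β g₀ j ^ 2) := by ring
      _ ≤ 1 * (cutoffWeight Ω k j * gbar P.β g₀ j ^ 2) := mul_le_mul_of_nonneg_right hwj1 (by positivity)
      _ = _ := one_mul _
  have hXg : X / g₀ ≤ 2 := by
    rw [div_le_iff₀ hg, hX]
    calc cutoffWeight Ω k j * gbar P.β g₀ j ≤ 1 * (2 * g₀) := mul_le_mul hwj1 hgj2 hgj zero_le_one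
      _ = 2 * g₀ := one_mul _
  -- the three kinds of products
  have t1 : |P.lamInvProdDeriv2 g₀ j l * P.sigma g₀ (l + j)| ≤
      (α ^ (l + 1) * (KΛ2 * X / g₀ ^ 3)) * (sigmaConst C c20 * (2 * X)) := by
    rw [abs_mul]
    exact mul_le_mul hΛ'' (hσ.trans (mul_le_mul_of_nonneg_left hs1 hKσ)) (abs_nonneg _) (by positivity)
  have t2 : |P.lamInvProdDeriv g₀ j l * P.sigmaDeriv g₀ (l + j)| ≤
      (α ^ (l + 1) * (α * Kτ * c20 * X / g₀ ^ 2)) * (sigmaDerivConst C c20 * (4 * X2) / g₀ ^ 2) := by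
    rw [abs_mul]
    exact mul_le_mul hΛ' (hσ'.trans (div_le_div_of_nonneg_right (mul_le_mul_of_nonneg_left hs2 hKσ')
      (by positivity))) (abs_nonneg _) (by positivity)
  have t3 : |P.lamInvProd g₀ j l * P.sigmaDeriv2 g₀ (l + j)| ≤
      α ^ (l + 1) * (sigmaDeriv2Const B C c20 * (4 * X2) / g₀ ^ 3) := by
    rw [abs_mul, abs_of_nonneg hP0]
    exact mul_le_mul hP1 (hσ''.trans (div_le_div_of_nonneg_right (mul_le_mul_of_nonneg_left hs2 hKσ2)
      (by positivity))) (abs_nonneg _) (pow_nonneg hα0 _)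
  refine (abs_add_le_of_le' (abs_add_le_of_le' t1 t2) (abs_add_le_of_le' t2 t3)).trans ?_
  have e : (α ^ (l + 1) * (KΛ2 * X / g₀ ^ 3)) * (sigmaConst C c20 * (2 * X)) +
      (α ^ (l + 1) * (α * Kτ * c20 * X / g₀ ^ 2)) * (sigmaDerivConst C c20 * (4 * X2) / g₀ ^ 2) +
      ((α ^ (l + 1) * (α * Kτ * c20 * X / g₀ ^ 2)) * (sigmaDerivConst C c20 * (4 * X2) / g₀ ^ 2) +
        α ^ (l + 1) * (sigmaDeriv2Const B C c20 * (4 * X2) / g₀ ^ 3)) =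
      (2 * KΛ2 * sigmaConst C c20 * X ^ 2 + 8 * α * Kτ * c20 * sigmaDerivConst C c20 * (X / g₀) * X2 +
        4 * sigmaDeriv2Const B C c20 * X2) * α ^ (l + 1) / g₀ ^ 3 := by
    field_simp
    ring
  rw [e, mubarDeriv2Const, ← hKτ, ← hKΛ2]
  rw [show (2 * KΛ2 * sigmaConst C c20 + 16 * α * Kτ * c20 * sigmaDerivConst C c20 + 4 * sigmaDeriv2Const B C c20) *
      α ^ (l + 1) * X2 / g₀ ^ 3 = ((2 * KΛ2 * sigmaConst C c20 + 16 * α * Kτ * c20 * sigmaDerivConst C c20 +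
      4 * sigmaDeriv2Const B C c20) * X2) * α ^ (l + 1) / g₀ ^ 3 by ring]
  refine div_le_div_of_nonneg_right (mul_le_mul_of_nonneg_right ?_ (pow_nonneg hα0 _)) (by positivity)
  have h1 : 2 * KΛ2 * sigmaConst C c20 * X ^ 2 ≤ 2 * KΛ2 * sigmaConst C c20 * X2 :=
    mul_le_mul_of_nonneg_left hXX (by positivity)
  have h2 : 8 * α * Kτ * c20 * sigmaDerivConst C c20 * (X / g₀) * X2 ≤ 8 * α * Kτ * c20 * sigmaDerivConst C c20 * 2 * X2 := by
    have h0 : 0 ≤ 8 * α * Kτ * c20 * sigmaDerivConst C c20 * X2 := by positivity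
    calc 8 * α * Kτ * c20 * sigmaDerivConst C c20 * (X / g₀) * X2
        = (8 * α * Kτ * c20 * sigmaDerivConst C c20 * X2) * (X / g₀) := by ring
      _ ≤ (8 * α * Kτ * c20 * sigmaDerivConst C c20 * X2) * 2 := mul_le_mul_of_nonneg_left hXg h0
      _ = _ := by ring
  linarith

end CutoffQuadHyp

/-! ### `μ̄_j'` is differentiable, `|μ̄_j''| ≤ K_{μ,2}χ_jḡ_j²/g₀³` -/

/-- **[BBS-rg-flow, Lemma 2.3] for `μ̄`, second derivative: `μ̄_j'` is differentiable in the initial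
condition**, with derivative `mubarDeriv2`, for `g₀ ∈ (0,b)` (termwise differentiation, M-test with the
geometric majorant). [cite: BauerschmidtBrydgesSlade2015Flow, Lemma 2.3 ("twice differentiable"), proof of (2.34) for μ̄] -/
theorem hasDerivAt_mubarDeriv (hb : CutoffQuadHyp P Ω k B c N C lam b)
    (hsmall : 8 * B ^ 2 * ((1 + N) / c + N + 2 * Ω / (Ω - 1)) * b ≤ 1) {g : ℝ} (hg : 0 < g)
    (hgb : g < b) (j : ℕ) : HasDerivAt (fun x => P.mubarDeriv x j) (P.mubarDeriv2 g j) g := by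
  have hGb := hb.toCutoffGbarHyp
  have hC := hb.C_nonneg
  have hB := hGb.B_nonneg
  have hC20 := hGb.C20_nonneg
  obtain ⟨hα0, hα1⟩ := hb.alpha_mem
  have ha0 : 0 < g / 2 := by positivity
  have hsm : ∀ x : ℝ, x ≤ b → 8 * B ^ 2 * ((1 + N) / c + N + 2 * Ω / (Ω - 1)) * x ≤ 1 := fun x hx =>
    le_trans (mul_le_mul_of_nonneg_left hx (mul_nonneg (by positivity) hC20)) hsmall
  have hyp : ∀ x ∈ Ioo (g / 2) b, CutoffQuadHyp P Ω k B c N C lam x := fun x hx =>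
    hb.mono (ha0.trans hx.1) hx.2.le
  have hmono : ∀ x ∈ Ioo (g / 2) b, ∀ n, gbar P.β x n ≤ gbar P.β b n := fun x hx n =>
    hGb.gbar_mono_init hsmall n (ha0.trans hx.1) hx.2.le le_rfl
  set M : ℝ := mubarDeriv2Const B C ((1 + N) / c + N + 2 * Ω / (Ω - 1)) (2 / (1 + lam)) with hM
  have hM0 : 0 ≤ M := mubarDeriv2Const_nonneg hB hC hC20 hα0
  set A : ℝ := M * (cutoffWeight Ω k j * gbar P.β b j ^ 2) / (g / 2) ^ 3 with hA
  have hu_sum : Summable fun l => A * (2 / (1 + lam)) ^ (l + 1) :=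
    ((summable_geometric_of_lt_one hα0 hα1).mul_left (A * (2 / (1 + lam)))).congr fun l => by ring
  -- summability of the differentiated series at `g` (first-order majorant)
  have hsum0 : Summable fun l => P.mubarDerivTerm g j l := by
    have hgq := hb.mono hg hgb.le
    set M1 : ℝ := mubarDerivConst C ((1 + N) / c + N + 2 * Ω / (Ω - 1)) (2 / (1 + lam))
    set A1 : ℝ := M1 * (cutoffWeight Ω k j * gbar P.β g j ^ 2) / g ^ 2
    have hgeom : Summable fun l : ℕ => A1 * (2 / (1 + lam)) ^ (l + 1) :=
      ((summable_geometric_of_lt_one hα0 hα1).mul_left (A1 * (2 / (1 + lam)))).congr fun l => by ring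
    refine Summable.of_norm_bounded hgeom fun l => ?_
    rw [Real.norm_eq_abs]
    refine (hgq.abs_mubarDerivTerm_le (hsm g hgb.le) j l).trans (le_of_eq ?_)
    show _ = A1 * (2 / (1 + lam)) ^ (l + 1)
    simp only [A1, M1]
    ring
  have e : (fun x => P.mubarDeriv x j) = fun x => -∑' l, P.mubarDerivTerm x j l := rfl
  rw [e, QuadFlowParams.mubarDeriv2]
  refine HasDerivAt.neg ?_
  refine hasDerivAt_tsum_of_isPreconnected (t := Ioo (g / 2) b) (y₀ := g) hu_sum isOpen_Ioo
    isPreconnected_Ioo (fun l x hx => hasDerivAt_mubarDerivTerm hb hsmall (ha0.trans hx.1) hx.2 j l)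
    (fun l x hx => ?_) ⟨by linarith, hgb⟩ hsum0 ⟨by linarith, hgb⟩
  have hx0 : 0 < x := ha0.trans hx.1
  have hGx := (hyp x hx).toCutoffGbarHyp
  have hwj := (hGx.weight_pos j).le
  have hgj := (hGx.gbar_pos j).le
  have hx3 : (g / 2) ^ 3 ≤ x ^ 3 := pow_le_pow_left₀ ha0.le hx.1.le 3
  have hnum : M * (2 / (1 + lam)) ^ (l + 1) * (cutoffWeight Ω k j * gbar P.β x j ^ 2) ≤
      M * (2 / (1 + lam)) ^ (l + 1) * (cutoffWeight Ω k j * gbar P.β b j ^ 2) := by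
    have := hmono x hx j
    gcongr
  rw [Real.norm_eq_abs]
  calc |P.mubarDerivTerm2 x j l|
      ≤ M * (2 / (1 + lam)) ^ (l + 1) * (cutoffWeight Ω k j * gbar P.β x j ^ 2) / x ^ 3 :=
        (hyp x hx).abs_mubarDerivTerm2_le (hsm x hx.2.le) j l
    _ ≤ M * (2 / (1 + lam)) ^ (l + 1) * (cutoffWeight Ω k j * gbar P.β b j ^ 2) / x ^ 3 :=
        div_le_div_of_nonneg_right hnum (by positivity)
    _ ≤ M * (2 / (1 + lam)) ^ (l + 1) * (cutoffWeight Ω k j * gbar P.β b j ^ 2) / (g / 2) ^ 3 :=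
        div_le_div_of_nonneg_left (by positivity) (by positivity) hx3
    _ = A * (2 / (1 + lam)) ^ (l + 1) := by rw [hA]; ring

/-- **[BBS-rg-flow, Lemma 2.3, (2.34) for `μ̄`]: `|μ̄_j''| ≤ K_{μ,2}χ_jḡ_j²/g₀³`**, `K_{μ,2} =
mubarDeriv2Const·α/(1-α)`. [cite: BauerschmidtBrydgesSlade2015Flow, Lemma 2.3, (2.34)] -/
theorem CutoffQuadHyp.abs_mubarDeriv2_le {g₀ : ℝ} (h : CutoffQuadHyp P Ω k B c N C lam g₀)
    (hsmall : 8 * B ^ 2 * ((1 + N) / c + N + 2 * Ω / (Ω - 1)) * g₀ ≤ 1) (j : ℕ) :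
    |P.mubarDeriv2 g₀ j| ≤
      mubarDeriv2Const B C ((1 + N) / c + N + 2 * Ω / (Ω - 1)) (2 / (1 + lam)) *
        ((2 / (1 + lam)) / (1 - 2 / (1 + lam))) * (cutoffWeight Ω k j * gbar P.β g₀ j ^ 2) / g₀ ^ 3 := by
  have hG := h.toCutoffGbarHyp
  have hg := hG.g₀_pos
  have hC := h.C_nonneg
  have hB := hG.B_nonneg
  have hC20 := hG.C20_nonneg
  obtain ⟨hα0, hα1⟩ := h.alpha_mem
  have hle0 : ∀ l, |P.mubarDerivTerm2 g₀ j l| ≤ _ := fun l => h.abs_mubarDerivTerm2_le hsmall j l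
  set α : ℝ := 2 / (1 + lam) with hα
  set M : ℝ := mubarDeriv2Const B C ((1 + N) / c + N + 2 * Ω / (Ω - 1)) α with hM
  have hM0 : 0 ≤ M := mubarDeriv2Const_nonneg hB hC hC20 hα0
  have hwj := (hG.weight_pos j).le
  have hgj := (hG.gbar_pos j).le
  set A : ℝ := M * (cutoffWeight Ω k j * gbar P.β g₀ j ^ 2) / g₀ ^ 3 with hA
  have hA0 : 0 ≤ A := by positivity
  have hgeo : HasSum (fun l : ℕ => α ^ (l + 1)) (α / (1 - α)) := by
    have h1 := (hasSum_geometric_of_lt_one hα0 hα1).mul_left α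
    simp only [← pow_succ'] at h1
    rwa [div_eq_mul_inv]
  have hv_sum : Summable fun l => A * α ^ (l + 1) := hgeo.summable.mul_left A
  have hle : ∀ l, |P.mubarDerivTerm2 g₀ j l| ≤ A * α ^ (l + 1) := fun l => by
    refine (hle0 l).trans (le_of_eq ?_)
    rw [hA, hM, hα]
    ring
  have hsum : Summable fun l => P.mubarDerivTerm2 g₀ j l :=
    Summable.of_norm_bounded hv_sum fun l => by rw [Real.norm_eq_abs]; exact hle l
  calc |P.mubarDeriv2 g₀ j| = |∑' l, P.mubarDerivTerm2 g₀ j l| := by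
        rw [QuadFlowParams.mubarDeriv2, abs_neg]
    _ ≤ ∑' l, |P.mubarDerivTerm2 g₀ j l| := by
        have := norm_tsum_le_tsum_norm (f := fun l => P.mubarDerivTerm2 g₀ j l)
          (by simpa only [Real.norm_eq_abs] using hsum.abs)
        simpa only [Real.norm_eq_abs] using this
    _ ≤ ∑' l, A * α ^ (l + 1) := Summable.tsum_le_tsum hle hsum.abs hv_sum
    _ = A * (α / (1 - α)) := by rw [tsum_mul_left, hgeo.tsum_eq]
    _ = _ := by rw [hA]; ring

end

/-! ### Lemma 2.3, second derivatives, assembled -/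

/-- **[BBS-rg-flow, Lemma 2.3] (second derivatives): the derivatives `ḡ_j', z̄_j', μ̄_j'` of the flow
`V̄_j` in the initial condition are themselves differentiable at every `g₀ ∈ (0, b)`, with
`|ḡ_j''| ≤ Kḡ_j²/g₀³`, `|z̄_j''|, |μ̄_j''| ≤ Kχ_jḡ_j²/g₀³`** ((2.34): `ḡ_j'' = O(ḡ_j²/ḡ₀³)`,
`z̄_j'', μ̄_j'' = O(χ_jḡ_j²/ḡ₀³)`), whenever the hypotheses of Lemma 2.2 hold at `b` with `8B²C_{2,0}b ≤ 1`.
[cite: BauerschmidtBrydgesSlade2015Flow, Lemma 2.3, (2.34)] -/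
theorem hasDerivAt_flowDeriv {P : QuadFlowParams} {Ω : ℝ} {k : ℕ∞} {B c : ℝ} {N : ℕ} {C lam b : ℝ}
    (hb : CutoffQuadHyp P Ω k B c N C lam b)
    (hsmall : 8 * B ^ 2 * ((1 + N) / c + N + 2 * Ω / (Ω - 1)) * b ≤ 1) {g : ℝ} (hg : 0 < g)
    (hgb : g < b) (j : ℕ) :
    HasDerivAt (fun x => gbarDeriv P.β x j) (gbarDeriv2 P.β g j) g ∧
      HasDerivAt (fun x => P.zbarDeriv x j) (P.zbarDeriv2 g j) g ∧
      HasDerivAt (fun x => P.mubarDeriv x j) (P.mubarDeriv2 g j) g ∧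
      |gbarDeriv2 P.β g j| ≤ 8 * B * ((1 + N) / c + N + 2 * Ω / (Ω - 1)) * gbar P.β g j ^ 2 / g ^ 3 ∧
      |P.zbarDeriv2 g j| ≤ zbarDeriv2Const B C ((1 + N) / c + N + 2 * Ω / (Ω - 1)) *
        (cutoffWeight Ω k j * gbar P.β g j ^ 2) / g ^ 3 ∧
      |P.mubarDeriv2 g j| ≤ mubarDeriv2Const B C ((1 + N) / c + N + 2 * Ω / (Ω - 1)) (2 / (1 + lam)) *
        ((2 / (1 + lam)) / (1 - 2 / (1 + lam))) * (cutoffWeight Ω k j * gbar P.β g j ^ 2) / g ^ 3 := by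
  have hgx := hb.mono hg hgb.le
  have hC20 := hb.toCutoffGbarHyp.C20_nonneg
  have hsg : 8 * B ^ 2 * ((1 + N) / c + N + 2 * Ω / (Ω - 1)) * g ≤ 1 :=
    le_trans (mul_le_mul_of_nonneg_left hgb.le (mul_nonneg (by positivity) hC20)) hsmall
  exact ⟨hasDerivAt_gbarDeriv P.β j g, hasDerivAt_zbarDeriv hb hsmall hg hgb j,
    hasDerivAt_mubarDeriv hb hsmall hg hgb j, hgx.toCutoffGbarHyp.abs_gbarDeriv2_le hsg j,
    hgx.abs_zbarDeriv2_le hsg j, hgx.abs_mubarDeriv2_le hsg j⟩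

end CTWSAW

end Literature.Barriers.CriticalPhenomena
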